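import Mathlib
import HarnessLib
import Summits.HubbardSuperconductivity.HubbardSuperconductivity.Theorems.KLProgrammeKLRegimeEnginePairTransferMemberConservation
import Summits.HubbardSuperconductivity.HubbardSuperconductivity.Theorems.KLProgrammeKLRegimeEnginePairTransferMemberFlow
import Summits.HubbardSuperconductivity.HubbardSuperconductivity.Theorems.KLProgrammeKLRegimeWickDressedLines
import Summits.HubbardSuperconductivity.HubbardSuperconductivity.Theorems.KLProgrammeKLRegimeTwoPointAssemblyDiag
import Summits.HubbardSuperconductivity.HubbardSuperconductivity.Theorems.KLProgrammeKLRegimeWickScaleFlowSource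

/-!
# Route `KLProgramme` — ENGINE child gen 8 (stmt-HubbardSuperconductivity-20437 `KLRegimeEngineV17F2`), skeleton v2 class #5 rev 3: the LINE VALUE of a member's smearing
# covariance and the member's SOURCE SPLIT at real cutoff — `klmc_contr_softCovOf_eq_diagContr`, `klmc_contr_memberCov_eq_diagContr`, **`klmc_member_source_split`**
# (cell gate-hubbard-kl, seat hubbard-kl-k3c1-p1 g11, technique «composed-map remainder propagation»)

WHY.  `klmc_source_split` (`…MemberConservation`, p595671) isolates the pp-ladder term of the bilinear Wick source of a carrier `e^{Δ_D}𝒢^K_Λ` for ANY scaling-invariant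
`D` with diagonal line value `ℓ₂`.  For the MEMBER carrier of `…MemberFlow` (`D = softCovOf K ψ + C^K_{>Λ₁} − C^K_{>Λ} = softCovOf K φ_Λ`, `φ_Λ = ψ + (w_{Λ₁} − w_Λ)`) this file supplies
the line value — `ℓ_φ(p) = φ(p)·βL²·ĝ_K(p)` (`klmc_contr_softCovOf_eq_diagContr`, from `contr_normalCovariance_eq_diagContr` and `propCT_eq_div_nambuDenCT`) — and states the
split with the member's lines `(Ċ_Λ, softCovOf φ_Λ)`: **`klmc_member_source_split`** — the derivative of the member's resolved pair kernel (`klmf_hasDerivAt_vertexFn_member`, in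
cross form by `klws_gaussConv_derivPairing_eq_dblFold_cross`) `= −(βL²)⁻³·Σ_z λ_φ(z)·K(x,z)K(z,y) + [non-ladder classes]`, `λ_φ(z) = ℓ_φ(p)ℓ_Ċ(p̄) + ℓ_Ċ(p)ℓ_φ(p̄)` — the RESOLVED
pp rung of the member (p1's `hasDerivAt_runningSmearedWeight` is its frequency aggregate), so that the Riccati defect `ξᵢ` of the SIZES bundle is, by name, the non-ladder classes
`(e^{Δ_×D} − Δ_×D)`-terms, `PHd`, `PHx`, `S62` of the member carrier plus the frequency-localisation of the pinned array.
Exact algebra over landed lemmas; nothing about the model's sizes is asserted; nothing asserts superconductivity.  0 kit.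
-/

noncomputable section

namespace Summit.HubbardSuperconductivity.HubbardSuperconductivity.Theorems.KLRegimeWick

set_option linter.dupNamespace false -- summit = problem name (single-conjunct summit), D-0017

open Literature.MathematicalPhysics.QuantumLattice GrassmannAlgebra Finset Matrix
open Literature.Probability.LatticeModels
open Summit.HubbardSuperconductivity.HubbardSuperconductivity.Theorems.TwoPointAssembly
open Summit.HubbardSuperconductivity.HubbardSuperconductivity.Theorems.KLProgrammeLegKernels
open Summit.HubbardSuperconductivity.HubbardSuperconductivity.Theorems.KLRegimeSplit

section Lines

variable {L M : ℕ} [NeZero L] (β μ : ℝ) (K : TrigPolyC4v)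

omit [NeZero L] in
/-- **The smearing covariance of a symbol is a diagonal line with value `φ(p)·βL²·ĝ_K(p)`** (`β ≠ 0`). -/
theorem klmc_contr_softCovOf_eq_diagContr (hβ : β ≠ 0) (φ : FreqMomentum L M → ℝ) :
    contr ℂ (softCovOf L M β μ K φ) = diagContr L M (fun p => (φ p : ℂ) * ((((β * (L : ℝ) ^ 2 : ℝ) : ℂ)) * propCT L M β μ K p)) := by
  refine (contr_normalCovariance_eq_diagContr (L := L) (M := M) (fun k => (φ k : ℂ) *
    ((((β * (L : ℝ) ^ 2 : ℝ) : ℂ)) * ((Complex.I * matsubaraFreq β M k.1 + nambuXiCT L μ K k.2) / nambuDenCT L M β μ 0 K k)))).trans ?_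
  congr 1
  funext p
  rw [propCT_eq_div_nambuDenCT hβ μ K p]

/-- **The member carrier's Wick covariance is a diagonal line with value `φ_Λ(p)·βL²·ĝ_K(p)`**, `φ_Λ = ψ + (w_{Λ₁} − w_Λ)` (by `klmf_carrierCov_eq`). -/
theorem klmc_contr_memberCov_eq_diagContr (hβ : β ≠ 0) (ψ : FreqMomentum L M → ℝ) (Λ₁ Λ : ℝ) :
    contr ℂ (softCovOf L M β μ K ψ + hubbardCovAboveCT L M β μ 0 K Λ₁ - hubbardCovAboveCT L M β μ 0 K Λ) =
      diagContr L M (fun p => ((ψ p + (hubbardCutoffWeightCT L M β μ K Λ₁ p - hubbardCutoffWeightCT L M β μ K Λ p) : ℝ) : ℂ) *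
        ((((β * (L : ℝ) ^ 2 : ℝ) : ℂ)) * propCT L M β μ K p)) := by
  rw [klmf_carrierCov_eq, klmc_contr_softCovOf_eq_diagContr β μ K hβ]

end Lines

section Split

variable {L M : ℕ} [NeZero L] [NeZero M] (β U μ : ℝ) (K : TrigPolyC4v)

/-- **The member's source split at real cutoff** (`β ≠ 0`, `Λ ≠ 0`): the cross-form source of the member carrier `𝓜_Λ = e^{Δ_{S_ψ + C_{>Λ₁} − C_{>Λ}}}𝒢^K_Λ` with the lines
`(Ċ_Λ, softCovOf φ_Λ)` splits as in `klmc_source_split` with `ℓ₁ = ẇ_Λ·βL²·ĝ_K` and `ℓ₂ = φ_Λ·βL²·ĝ_K`. -/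
theorem klmc_member_source_split (hβ : β ≠ 0) (ψ : FreqMomentum L M → ℝ) (Λ₁ : ℝ) {Λ : ℝ} (hΛ : Λ ≠ 0) (Q : TorusSite 2 L)
    (x y : TorusSite 2 L × MatsubaraIdx M) :
    -((2 : ℂ)⁻¹ * vertexFn L M β (dblFold ℂ (grassmannLaplacian ℂ (crossCov ℂ (Matrix.of fun X Y : HubbardFieldIdx L M => deriv (fun Λ'' : ℝ => hubbardCovAboveCT L M β μ 0 K Λ'' X Y) Λ))
        (gaussConv ℂ (crossCov ℂ (softCovOf L M β μ K ψ + hubbardCovAboveCT L M β μ 0 K Λ₁ - hubbardCovAboveCT L M β μ 0 K Λ)) (dblCopy ℂ 0 (gaussConv ℂ (softCovOf L M β μ K ψ + hubbardCovAboveCT L M β μ 0 K Λ₁ - hubbardCovAboveCT L M β μ 0 K Λ) (hubbardEffectiveActionCT L M β U μ 0 K Λ)) * dblCopy ℂ 1 (gaussConv ℂ (softCovOf L M β μ K ψ + hubbardCovAboveCT L M β μ 0 K Λ₁ - hubbardCovAboveCT L M β μ 0 K Λ) (hubbardEffectiveActionCT L M β U μ 0 K Λ)))))) 4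
        ![(((y.2, y.1), 0), 0), (((y.2.rev, Q - y.1), 1), 0), (((x.2.rev, Q - x.1), 1), 1), (((x.2, x.1), 0), 1)]) =
      -(((((β * (L : ℝ) ^ 2 : ℝ) : ℂ)) ^ 3)⁻¹ *
          (∑ z : TorusSite 2 L × MatsubaraIdx M,
            (((((ψ (z.2, z.1) + (hubbardCutoffWeightCT L M β μ K Λ₁ (z.2, z.1) - hubbardCutoffWeightCT L M β μ K Λ (z.2, z.1))) : ℝ) : ℂ) * ((((β * (L : ℝ) ^ 2 : ℝ) : ℂ)) * propCT L M β μ K (z.2, z.1))) * ((((deriv (fun Λ' : ℝ => hubbardCutoffWeightCT L M β μ K Λ' (z.2.rev, Q - z.1)) Λ) : ℝ) : ℂ) * ((((β * (L : ℝ) ^ 2 : ℝ) : ℂ)) * propCT L M β μ K (z.2.rev, Q - z.1))) + ((((deriv (fun Λ' : ℝ => hubbardCutoffWeightCT L M β μ K Λ' (z.2, z.1)) Λ) : ℝ) : ℂ) * ((((β * (L : ℝ) ^ 2 : ℝ) : ℂ)) * propCT L M β μ K (z.2, z.1))) * ((((ψ (z.2.rev, Q - z.1) + (hubbardCutoffWeightCT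 L M β μ K Λ₁ (z.2.rev, Q - z.1) - hubbardCutoffWeightCT L M β μ K Λ (z.2.rev, Q - z.1))) : ℝ) : ℂ) * ((((β * (L : ℝ) ^ 2 : ℝ) : ℂ)) * propCT L M β μ K (z.2.rev, Q - z.1)))) *
              (vertexFn L M β (gaussConv ℂ (softCovOf L M β μ K ψ + hubbardCovAboveCT L M β μ 0 K Λ₁ - hubbardCovAboveCT L M β μ 0 K Λ) (hubbardEffectiveActionCT L M β U μ 0 K Λ)) 4
                  ![(((z.2, z.1), 0), 0), (((z.2.rev, Q - z.1), 1), 0), (((x.2.rev, Q - x.1), 1), 1), (((x.2, x.1), 0), 1)] *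
                vertexFn L M β (gaussConv ℂ (softCovOf L M β μ K ψ + hubbardCovAboveCT L M β μ 0 K Λ₁ - hubbardCovAboveCT L M β μ 0 K Λ) (hubbardEffectiveActionCT L M β U μ 0 K Λ)) 4
                  ![(((y.2, y.1), 0), 0), (((y.2.rev, Q - y.1), 1), 0), (((z.2.rev, Q - z.1), 1), 1), (((z.2, z.1), 0), 1)]))) +
      (-((2 : ℂ)⁻¹ * vertexFn L M β (dblFold ℂ (grassmannLaplacian ℂ (crossCov ℂ (Matrix.of fun X Y : HubbardFieldIdx L M => deriv (fun Λ'' : ℝ => hubbardCovAboveCT L M β μ 0 K Λ'' X Y) Λ))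
          ((gaussConv ℂ (crossCov ℂ (softCovOf L M β μ K ψ + hubbardCovAboveCT L M β μ 0 K Λ₁ - hubbardCovAboveCT L M β μ 0 K Λ)) - grassmannLaplacian ℂ (crossCov ℂ (softCovOf L M β μ K ψ + hubbardCovAboveCT L M β μ 0 K Λ₁ - hubbardCovAboveCT L M β μ 0 K Λ)))
            (dblCopy ℂ 0 (gaussConv ℂ (softCovOf L M β μ K ψ + hubbardCovAboveCT L M β μ 0 K Λ₁ - hubbardCovAboveCT L M β μ 0 K Λ) (hubbardEffectiveActionCT L M β U μ 0 K Λ)) * dblCopy ℂ 1 (gaussConv ℂ (softCovOf L M β μ K ψ + hubbardCovAboveCT L M β μ 0 K Λ₁ - hubbardCovAboveCT L M β μ 0 K Λ) (hubbardEffectiveActionCT L M β U μ 0 K Λ)))))) 4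
          ![(((y.2, y.1), 0), 0), (((y.2.rev, Q - y.1), 1), 0), (((x.2.rev, Q - x.1), 1), 1), (((x.2, x.1), 0), 1)]) -
        ((((β * (L : ℝ) ^ 2 : ℝ) : ℂ)) ^ 3)⁻¹ *
          ((∑ p : FreqMomentum L M, ∑ σ : Fin 2, ∑ p' : FreqMomentum L M,
            if matsubaraInt M p'.1 + matsubaraInt M y.2 = matsubaraInt M p.1 + matsubaraInt M x.2 ∧ p'.2 = p.2 + x.1 - y.1 then
              (((((ψ p + (hubbardCutoffWeightCT L M β μ K Λ₁ p - hubbardCutoffWeightCT L M β μ K Λ p)) : ℝ) : ℂ) * ((((β * (L : ℝ) ^ 2 : ℝ) : ℂ)) * propCT L M β μ K p)) * ((((deriv (fun Λ' : ℝ => hubbardCutoffWeightCT L M β μ K Λ' p') Λ) : ℝ) : ℂ) * ((((β * (L : ℝ) ^ 2 : ℝ) : ℂ)) * propCT L M β μ K p')) + ((((deriv (fun Λ' : ℝ => hubbardCutoffWeightCT L M β μ K Λ' p) Λ) : ℝ) : ℂ) * ((((β * (L : ℝ) ^ 2 : ℝ) : ℂ)) * propCT L M β μ K p)) * ((((ψ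 p' + (hubbardCutoffWeightCT L M β μ K Λ₁ p' - hubbardCutoffWeightCT L M β μ K Λ p')) : ℝ) : ℂ) * ((((β * (L : ℝ) ^ 2 : ℝ) : ℂ)) * propCT L M β μ K p'))) *
                (vertexFn L M β (gaussConv ℂ (softCovOf L M β μ K ψ + hubbardCovAboveCT L M β μ 0 K Λ₁ - hubbardCovAboveCT L M β μ 0 K Λ) (hubbardEffectiveActionCT L M β U μ 0 K Λ)) 4
                    ![((p, σ), 1), ((p', σ), 0), (((y.2, y.1), 0), 0), (((x.2, x.1), 0), 1)] *
                  vertexFn L M β (gaussConv ℂ (softCovOf L M β μ K ψ + hubbardCovAboveCT L M β μ 0 K Λ₁ - hubbardCovAboveCT L M β μ 0 K Λ) (hubbardEffectiveActionCT L M β U μ 0 K Λ)) 4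
                    ![((p, σ), 0), ((p', σ), 1), (((y.2.rev, Q - y.1), 1), 0), (((x.2.rev, Q - x.1), 1), 1)])
            else 0) -
          (∑ p : FreqMomentum L M, ∑ p' : FreqMomentum L M,
            if matsubaraInt M p'.1 + matsubaraInt M x.2 + matsubaraInt M y.2 + 1 = matsubaraInt M p.1 ∧ p'.2 = p.2 + Q - x.1 - y.1 then
              (((((ψ p + (hubbardCutoffWeightCT L M β μ K Λ₁ p - hubbardCutoffWeightCT L M β μ K Λ p)) : ℝ) : ℂ) * ((((β * (L : ℝ) ^ 2 : ℝ) : ℂ)) * propCT L M β μ K p)) * ((((deriv (fun Λ' : ℝ => hubbardCutoffWeightCT L M β μ K Λ' p') Λ) : ℝ) : ℂ) * ((((β * (L : ℝ) ^ 2 : ℝ) : ℂ)) * propCT L M β μ K p')) + ((((deriv (fun Λ' : ℝ => hubbardCutoffWeightCT L M β μ K Λ' p) Λ) : ℝ) : ℂ) * ((((β * (L : ℝ) ^ 2 : ℝ) : ℂ)) * propCT L M β μ K p)) * ((((ψ p' + (hubbardCutoffWeightCT L M β μ K Λ₁ p' - hubbardCutoffWeightCT L M β μ K Λ p')) : ℝ)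 : ℂ) * ((((β * (L : ℝ) ^ 2 : ℝ) : ℂ)) * propCT L M β μ K p'))) *
                (vertexFn L M β (gaussConv ℂ (softCovOf L M β μ K ψ + hubbardCovAboveCT L M β μ 0 K Λ₁ - hubbardCovAboveCT L M β μ 0 K Λ) (hubbardEffectiveActionCT L M β U μ 0 K Λ)) 4
                    ![((p, 0), 1), ((p', 1), 0), (((y.2, y.1), 0), 0), (((x.2.rev, Q - x.1), 1), 1)] *
                  vertexFn L M β (gaussConv ℂ (softCovOf L M β μ K ψ + hubbardCovAboveCT L M β μ 0 K Λ₁ - hubbardCovAboveCT L M β μ 0 K Λ) (hubbardEffectiveActionCT L M β U μ 0 K Λ)) 4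
                    ![((p, 0), 0), ((p', 1), 1), (((y.2.rev, Q - y.1), 1), 0), (((x.2, x.1), 0), 1)])
            else 0) -
          2 * ∑ p : FreqMomentum L M, ∑ σ : Fin 2, ((((deriv (fun Λ' : ℝ => hubbardCutoffWeightCT L M β μ K Λ' p) Λ) : ℝ) : ℂ) * ((((β * (L : ℝ) ^ 2 : ℝ) : ℂ)) * propCT L M β μ K p)) * ((((ψ p + (hubbardCutoffWeightCT L M β μ K Λ₁ p - hubbardCutoffWeightCT L M β μ K Λ p)) : ℝ) : ℂ) * ((((β * (L : ℝ) ^ 2 : ℝ) : ℂ)) * propCT L M β μ K p)) *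
            (vertexFn L M β (gaussConv ℂ (softCovOf L M β μ K ψ + hubbardCovAboveCT L M β μ 0 K Λ₁ - hubbardCovAboveCT L M β μ 0 K Λ) (hubbardEffectiveActionCT L M β U μ 0 K Λ)) 6
                ![((p, σ), 0), ((p, σ), 1), (((y.2, y.1), 0), 0), (((y.2.rev, Q - y.1), 1), 0), (((x.2.rev, Q - x.1), 1), 1),
                  (((x.2, x.1), 0), 1)] *
              selfEnergy L M β (gaussConv ℂ (softCovOf L M β μ K ψ + hubbardCovAboveCT L M β μ 0 K Λ₁ - hubbardCovAboveCT L M β μ 0 K Λ) (hubbardEffectiveActionCT L M β U μ 0 K Λ)) p σ))) :=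
  klmc_source_split β U μ K hβ (fun φ hφ X Y => klmc_memberCov_invariant β μ K ψ Λ₁ Λ φ hφ X Y)
    (klws_contr_derivHardCov_eq_diagContr L M hβ μ K hΛ) (klmc_contr_memberCov_eq_diagContr β μ K hβ ψ Λ₁ Λ) Λ Q x y

end Split

end Summit.HubbardSuperconductivity.HubbardSuperconductivity.Theorems.KLRegimeWick

end
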